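import Summits.AtomisticToContinuum.Crystallization.Theorems.FreeSplittingCertificatesStrictSplittingRuleFarPencilGrowth

/-!
# `StrictSplittingRule` (stmt-AtomisticToContinuum-12560): the weighted continuum far pencil for LINEAR-GROWTH and AFFINE-TAILED fields

Route `FreeSplittingCertificates`, crux r3 `StrictSplittingRule` (H12⋆ = `stub_coreJointCoercive`), unit b2b-freesplit-B gen 12.
VALUE = the continuum far lemma of the H12⋆ architecture in the form the architecture actually consumes.  The far field there is
the co-rotated lattice displacement `v = u − u_P − W(y − y_P)` (interpolated), which is AFFINE outside the support of `u` — not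
compactly supported (so `farPencil_weighted_integral_le` does not apply) and with eight integrability hypotheses left open by
`farPencil_weighted_integral_le_of_integrable` (gen 11).  Here they are discharged:

* `isBigO_fpFluxDeriv_gauge`: `∂ₖΦⱼ = O(‖y‖⁻⁵)` along a `C²` field with `v = O(‖y‖)`, `∇v = O(1)`, `∇²v = O(1)` (with `…FarPencilGrowth`:
  `Num, Den = O(‖y‖⁻⁶)`, `Φ = O(‖y‖⁻⁵)`);
* continuity of the weighted integrands (the weight `χ`, vanishing near the reference site, kills the `|x|⁻ᵏ` singularity);
* **`farPencil_weighted_integral_le_of_growth`**: for `v ∈ C²` of linear growth and a `C²` weight `χ` with `0 ∉ tsupport χ`,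
  `χ = O(1)`, `∇χ = O(1)`:  `∫ χ²·Num ≤ (17/200)·∫ χ²·Den + (1/18)·∫ 2χ⟪∇χ, Φ⟫`;
* **`farPencil_weighted_integral_le_of_affineTail`**: the same for `v` affine outside a ball (`v y = b + y·A` for `‖y‖ ≥ R`) and
  `χ = 1` for `‖y‖ ≥ R` — hypotheses stated on `v` and `χ` only (the derivative facts `∇v = A`, `∇²v = 0`, `∇χ = 0` on the tail
  region are derived: `fpGrad_fpHess_of_affineTail`, `fpGradS_eq_zero_of_tail`).
HONEST FRAMING: theorems about continuum test fields; the lattice→continuum transfer, the near certificate and the tail bookkeeping of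
the readout bonds are untouched; NOT a proof of H12⋆, NOT summit progress.
-/

noncomputable section

open MeasureTheory Topology Filter Asymptotics

namespace Summit.AtomisticToContinuum.Crystallization.Theorems.StrictSplittingRuleBirth

/-! ## The flux derivative along a field of linear growth with bounded Hessian -/

section growthH
variable {v : (Fin 3 → ℝ) → (Fin 3 → ℝ)}
  (hvO : ∀ i, (fun y => v y i) =O[cocompact (Fin 3 → ℝ)] fun y => ‖y‖ ^ (1 : ℤ))
  (hGO : ∀ i j, (fun y => fpGrad v y i j) =O[cocompact (Fin 3 → ℝ)] fun y => ‖y‖ ^ (0 : ℤ))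
  (hHO : ∀ k i j, (fun y => fpHess v y k i j) =O[cocompact (Fin 3 → ℝ)] fun y => ‖y‖ ^ (0 : ℤ))
include hvO hGO hHO

/-- **Flux derivative `∂ₖΦⱼ = O(‖y‖⁻⁵)`** along a field with `v = O(‖y‖)`, `∇v = O(1)`, `∇²v = O(1)`. -/
theorem isBigO_fpFluxDeriv_gauge (j k : Fin 3) :
    (fun y => fpFluxDeriv v y j k) =O[cocompact (Fin 3 → ℝ)] fun y => ‖y‖ ^ (-5 : ℤ) := by
  -- the bracket `A = |v|² yⱼ + 7⟪y,v⟫vⱼ = O(‖y‖³)`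
  have hA : (fun y => fpSq (v y) * y j + 7 * fpDot y (v y) * v y j) =O[cocompact (Fin 3 → ℝ)]
      fun y => ‖y‖ ^ (3 : ℤ) :=
    (isBigO_gauge_up (isBigO_gauge_mul' (isBigO_vSq_gauge hvO) (isBigO_coord_gauge j)) (by norm_num)).add
      (isBigO_gauge_up (isBigO_gauge_mul' (isBigO_gauge_mul' (isBigO_const_gauge 7) (isBigO_vDot_gauge hvO))
        (hvO j)) (by norm_num))
  -- T1 = −8⟪y,eₖ⟫·s⁻⁵·A
  have hT1 : (fun y => -8 * fpDot y (fpE k) * (fpSq y)⁻¹ ^ 5 * (fpSq (v y) * y j + 7 * fpDot y (v y) * v y j))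
      =O[cocompact (Fin 3 → ℝ)] fun y => ‖y‖ ^ (-5 : ℤ) :=
    isBigO_gauge_up (isBigO_gauge_mul' (isBigO_gauge_mul' (isBigO_gauge_mul' (isBigO_const_gauge (-8))
      (isBigO_dotE_gauge k)) (isBigO_fpSq_inv_pow_gauge 5)) hA) (by norm_num)
  -- T2 = s⁻⁴·B with B = O(‖y‖²)
  have hB1 : (fun y => 2 * (v y 0 * fpGrad v y k 0 + v y 1 * fpGrad v y k 1 + v y 2 * fpGrad v y k 2) * y j)
      =O[cocompact (Fin 3 → ℝ)] fun y => ‖y‖ ^ (2 : ℤ) :=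
    isBigO_gauge_up (isBigO_gauge_mul' ((isBigO_vGrow_gauge hvO hGO k).const_mul_left 2) (isBigO_coord_gauge j))
      (by norm_num)
  have hB2 : (fun y => fpSq (v y) * fpE k j) =O[cocompact (Fin 3 → ℝ)] fun y => ‖y‖ ^ (2 : ℤ) :=
    isBigO_gauge_up (isBigO_gauge_mul' (isBigO_vSq_gauge hvO) (isBigO_const_gauge (fpE k j))) (by norm_num)
  have hB3 : (fun y => 7 * (fpDot (fpE k) (v y) + (y 0 * fpGrad v y k 0 + y 1 * fpGrad v y k 1 + y 2 * fpGrad v y k 2))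
      * v y j) =O[cocompact (Fin 3 → ℝ)] fun y => ‖y‖ ^ (2 : ℤ) :=
    isBigO_gauge_up (isBigO_gauge_mul' (((isBigO_Edot_gauge hvO k).add (isBigO_xGrow_gauge hGO k)).const_mul_left 7)
      (hvO j)) (by norm_num)
  have hB4 : (fun y => 7 * fpDot y (v y) * fpGrad v y k j) =O[cocompact (Fin 3 → ℝ)] fun y => ‖y‖ ^ (2 : ℤ) :=
    isBigO_gauge_up (isBigO_gauge_mul' ((isBigO_vDot_gauge hvO).const_mul_left 7) (hGO k j)) (by norm_num)
  have hT2 := isBigO_gauge_up (isBigO_gauge_mul' (isBigO_fpSq_inv_pow_gauge 4) (((hB1.add hB2).add hB3).add hB4))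
    (show -2 * ((4 : ℕ) : ℤ) + 2 ≤ -5 by norm_num)
  -- T3 = 6⟪y,eₖ⟫·s⁻⁴·(Σᵢ vᵢ∂ᵢvⱼ − (div v)vⱼ)
  have hT3 : (fun y => 6 * fpDot y (fpE k) * (fpSq y)⁻¹ ^ 4 *
      (v y 0 * fpGrad v y 0 j + v y 1 * fpGrad v y 1 j + v y 2 * fpGrad v y 2 j - fpTr (fpGrad v y) * v y j))
      =O[cocompact (Fin 3 → ℝ)] fun y => ‖y‖ ^ (-5 : ℤ) :=
    isBigO_gauge_up (isBigO_gauge_mul' (isBigO_gauge_mul' (isBigO_gauge_mul' (isBigO_const_gauge 6)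
      (isBigO_dotE_gauge k)) (isBigO_fpSq_inv_pow_gauge 4)) (isBigO_vGcol_gauge hvO hGO j)) (by norm_num)
  -- T4 = s⁻³·C with C = O(‖y‖)
  have hGG : (fun y => fpGrad v y k 0 * fpGrad v y 0 j + fpGrad v y k 1 * fpGrad v y 1 j + fpGrad v y k 2 * fpGrad v y 2 j)
      =O[cocompact (Fin 3 → ℝ)] fun y => ‖y‖ ^ (1 : ℤ) := by
    have h : ∀ i : Fin 3, (fun y => fpGrad v y k i * fpGrad v y i j) =O[cocompact (Fin 3 → ℝ)]
        fun y => ‖y‖ ^ (1 : ℤ) :=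
      fun i => isBigO_gauge_up (isBigO_gauge_mul' (hGO k i) (hGO i j)) (by norm_num)
    exact ((h 0).add (h 1)).add (h 2)
  have hvH : (fun y => v y 0 * fpHess v y k 0 j + v y 1 * fpHess v y k 1 j + v y 2 * fpHess v y k 2 j)
      =O[cocompact (Fin 3 → ℝ)] fun y => ‖y‖ ^ (1 : ℤ) := by
    have h : ∀ i : Fin 3, (fun y => v y i * fpHess v y k i j) =O[cocompact (Fin 3 → ℝ)] fun y => ‖y‖ ^ (1 : ℤ) :=
      fun i => isBigO_gauge_up (isBigO_gauge_mul' (hvO i) (hHO k i j)) (by norm_num)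
    exact ((h 0).add (h 1)).add (h 2)
  have htrH : (fun y => (fpHess v y k 0 0 + fpHess v y k 1 1 + fpHess v y k 2 2) * v y j)
      =O[cocompact (Fin 3 → ℝ)] fun y => ‖y‖ ^ (1 : ℤ) :=
    isBigO_gauge_up (isBigO_gauge_mul' (((hHO k 0 0).add (hHO k 1 1)).add (hHO k 2 2)) (hvO j)) (by norm_num)
  have htrG : (fun y => fpTr (fpGrad v y) * fpGrad v y k j) =O[cocompact (Fin 3 → ℝ)] fun y => ‖y‖ ^ (1 : ℤ) :=
    isBigO_gauge_up (isBigO_gauge_mul' (isBigO_tr_gauge hGO) (hGO k j)) (by norm_num)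
  have hT4 := isBigO_gauge_up (isBigO_gauge_mul' (isBigO_fpSq_inv_pow_gauge 3) (((hGG.add hvH).sub htrH).sub htrG))
    (show -2 * ((3 : ℕ) : ℤ) + 1 ≤ -5 by norm_num)
  exact ((hT1.add hT2).sub hT3).add hT4

end growthH

/-! ## Continuity of the weighted integrands (the weight kills the singularity at the reference site) -/

/-- `g·w` is continuous when `w` is continuous and vanishes near `0` and `g` is continuous away from `0`. -/
theorem continuous_mul_weight {g w : (Fin 3 → ℝ) → ℝ} (hw : Continuous w) (hw0 : ∀ᶠ y in 𝓝 (0 : Fin 3 → ℝ), w y = 0)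
    (hg : ∀ y : Fin 3 → ℝ, y ≠ 0 → ContinuousAt g y) : Continuous fun y => g y * w y := by
  refine continuous_iff_continuousAt.2 fun y => ?_
  by_cases hy : y = 0
  · subst hy
    have hev : (fun y => g y * w y) =ᶠ[𝓝 (0 : Fin 3 → ℝ)] fun _ => (0 : ℝ) := by
      filter_upwards [hw0] with z hz
      simp [hz]
    exact hev.continuousAt
  · exact (hg y hy).mul hw.continuousAt

/-- `w·g` is continuous when `w` is continuous and vanishes near `0` and `g` is continuous away from `0`. -/
theorem continuous_weight_mul {g w : (Fin 3 → ℝ) → ℝ} (hw : Continuous w) (hw0 : ∀ᶠ y in 𝓝 (0 : Fin 3 → ℝ), w y = 0)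
    (hg : ∀ y : Fin 3 → ℝ, y ≠ 0 → ContinuousAt g y) : Continuous fun y => w y * g y := by
  refine continuous_iff_continuousAt.2 fun y => ?_
  by_cases hy : y = 0
  · subst hy
    have hev : (fun y => w y * g y) =ᶠ[𝓝 (0 : Fin 3 → ℝ)] fun _ => (0 : ℝ) := by
      filter_upwards [hw0] with z hz
      simp [hz]
    exact hev.continuousAt
  · exact hw.continuousAt.mul (hg y hy)

section weights
variable {χ : (Fin 3 → ℝ) → ℝ}

/-- `∂ⱼχ` is continuous for a `C²` weight. -/
theorem continuous_fpGradS (hχ : ContDiff ℝ 2 χ) (j : Fin 3) : Continuous fun y => fpGradS χ y j :=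
  (continuous_apply j).comp (continuous_pi fun i => (hχ.continuous_fderiv (by simp)).clm_apply continuous_const)

/-- `2χ∂ⱼχ` is continuous for a `C²` weight. -/
theorem continuous_two_mul_chi_grad (hχ : ContDiff ℝ 2 χ) (j : Fin 3) : Continuous fun y => 2 * χ y * fpGradS χ y j :=
  ((hχ.continuous.const_mul 2).mul (continuous_fpGradS hχ j))

/-- `χ²` vanishes near `0` when `0 ∉ tsupport χ`. -/
theorem chiSq_eventually_zero (hχ0 : (0 : Fin 3 → ℝ) ∉ tsupport χ) : ∀ᶠ y in 𝓝 (0 : Fin 3 → ℝ), χ y ^ 2 = 0 := by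
  filter_upwards [fpGradS_eventually_zero hχ0] with y hy
  simp [hy.1]

/-- `2χ∂ⱼχ` vanishes near `0` when `0 ∉ tsupport χ`. -/
theorem two_mul_chi_grad_eventually_zero (hχ0 : (0 : Fin 3 → ℝ) ∉ tsupport χ) (j : Fin 3) :
    ∀ᶠ y in 𝓝 (0 : Fin 3 → ℝ), 2 * χ y * fpGradS χ y j = 0 := by
  filter_upwards [fpGradS_eventually_zero hχ0] with y hy
  simp [hy.1]

end weights

/-! ## Integrability of the eight weighted densities and the far pencil for the linear-growth class -/

section main
variable {v : (Fin 3 → ℝ) → (Fin 3 → ℝ)} {χ : (Fin 3 → ℝ) → ℝ}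
  (hv : ContDiff ℝ 2 v) (hχ : ContDiff ℝ 2 χ) (hχ0 : (0 : Fin 3 → ℝ) ∉ tsupport χ)

/-- `χ² = O(1)` when `χ = O(1)`. -/
theorem isBigO_chiSq_gauge (hχO : (fun y => χ y) =O[cocompact (Fin 3 → ℝ)] fun y => ‖y‖ ^ (0 : ℤ)) :
    (fun y => χ y ^ 2) =O[cocompact (Fin 3 → ℝ)] fun y => ‖y‖ ^ (0 : ℤ) :=
  isBigO_gauge_up (isBigO_gauge_pow hχO 2) (by norm_num)

include hv hχ hχ0

/-- `χ²·Num` is integrable along a linear-growth field (`v = O(‖y‖)`, `∇v = O(1)`) with a bounded weight vanishing near `0`. -/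
theorem integrable_sq_mul_fpNum_of_growth
    (hvO : ∀ i, (fun y => v y i) =O[cocompact (Fin 3 → ℝ)] fun y => ‖y‖ ^ (1 : ℤ))
    (hGO : ∀ i j, (fun y => fpGrad v y i j) =O[cocompact (Fin 3 → ℝ)] fun y => ‖y‖ ^ (0 : ℤ))
    (hχO : (fun y => χ y) =O[cocompact (Fin 3 → ℝ)] fun y => ‖y‖ ^ (0 : ℤ)) :
    Integrable fun y => χ y ^ 2 * fpNum y (v y) (fpGrad v y) :=
  integrable_of_isBigO_gauge
    (continuous_weight_mul (hχ.continuous.pow 2) (chiSq_eventually_zero hχ0) fun y hy => continuousAt_fpNum hv hy)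
    (show (0 : ℤ) + -6 ≤ -4 by norm_num)
    (isBigO_gauge_mul' (isBigO_chiSq_gauge hχO) (isBigO_fpNum_gauge hvO hGO))

/-- `χ²·Den` is integrable along a field with `∇v = O(1)` and a bounded weight vanishing near `0`. -/
theorem integrable_sq_mul_fpDen_of_growth
    (hGO : ∀ i j, (fun y => fpGrad v y i j) =O[cocompact (Fin 3 → ℝ)] fun y => ‖y‖ ^ (0 : ℤ))
    (hχO : (fun y => χ y) =O[cocompact (Fin 3 → ℝ)] fun y => ‖y‖ ^ (0 : ℤ)) :
    Integrable fun y => χ y ^ 2 * fpDen y (fpGrad v y) :=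
  integrable_of_isBigO_gauge
    (continuous_weight_mul (hχ.continuous.pow 2) (chiSq_eventually_zero hχ0) fun y hy => continuousAt_fpDen hv hy)
    (show (0 : ℤ) + -6 ≤ -4 by norm_num)
    (isBigO_gauge_mul' (isBigO_chiSq_gauge hχO) (isBigO_fpDen_gauge hGO))

/-- `Φⱼ·χ²` is integrable along a linear-growth field with a bounded weight vanishing near `0`. -/
theorem integrable_fpFlux_mul_sq_of_growth
    (hvO : ∀ i, (fun y => v y i) =O[cocompact (Fin 3 → ℝ)] fun y => ‖y‖ ^ (1 : ℤ))
    (hGO : ∀ i j, (fun y => fpGrad v y i j) =O[cocompact (Fin 3 → ℝ)] fun y => ‖y‖ ^ (0 : ℤ))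
    (hχO : (fun y => χ y) =O[cocompact (Fin 3 → ℝ)] fun y => ‖y‖ ^ (0 : ℤ)) (j : Fin 3) :
    Integrable fun y => fpFlux v y j * χ y ^ 2 :=
  integrable_of_isBigO_gauge
    (continuous_mul_weight (hχ.continuous.pow 2) (chiSq_eventually_zero hχ0) fun y hy => continuousAt_fpFlux hv hy j)
    (show (-5 : ℤ) + 0 ≤ -4 by norm_num)
    (isBigO_gauge_mul' (isBigO_fpFlux_gauge hvO hGO j) (isBigO_chiSq_gauge hχO))

/-- `Φⱼ·(2χ∂ⱼχ)` is integrable along a linear-growth field with `χ, ∇χ = O(1)`. -/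
theorem integrable_fpFlux_mul_grad_sq_of_growth
    (hvO : ∀ i, (fun y => v y i) =O[cocompact (Fin 3 → ℝ)] fun y => ‖y‖ ^ (1 : ℤ))
    (hGO : ∀ i j, (fun y => fpGrad v y i j) =O[cocompact (Fin 3 → ℝ)] fun y => ‖y‖ ^ (0 : ℤ))
    (hχO : (fun y => χ y) =O[cocompact (Fin 3 → ℝ)] fun y => ‖y‖ ^ (0 : ℤ))
    (hχ1 : ∀ j, (fun y => fpGradS χ y j) =O[cocompact (Fin 3 → ℝ)] fun y => ‖y‖ ^ (0 : ℤ)) (j : Fin 3) :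
    Integrable fun y => fpFlux v y j * (2 * χ y * fpGradS χ y j) :=
  integrable_of_isBigO_gauge
    (continuous_mul_weight (continuous_two_mul_chi_grad hχ j) (two_mul_chi_grad_eventually_zero hχ0 j)
      fun y hy => continuousAt_fpFlux hv hy j)
    (show (-5 : ℤ) + (0 + 0 + 0) ≤ -4 by norm_num)
    (isBigO_gauge_mul' (isBigO_fpFlux_gauge hvO hGO j)
      (isBigO_gauge_mul' (isBigO_gauge_mul' (isBigO_const_gauge 2) hχO) (hχ1 j)))

/-- `∂ⱼΦⱼ·χ²` is integrable along a linear-growth field with `∇²v = O(1)` and a bounded weight vanishing near `0`. -/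
theorem integrable_fpFluxDeriv_mul_sq_of_growth
    (hvO : ∀ i, (fun y => v y i) =O[cocompact (Fin 3 → ℝ)] fun y => ‖y‖ ^ (1 : ℤ))
    (hGO : ∀ i j, (fun y => fpGrad v y i j) =O[cocompact (Fin 3 → ℝ)] fun y => ‖y‖ ^ (0 : ℤ))
    (hHO : ∀ k i j, (fun y => fpHess v y k i j) =O[cocompact (Fin 3 → ℝ)] fun y => ‖y‖ ^ (0 : ℤ))
    (hχO : (fun y => χ y) =O[cocompact (Fin 3 → ℝ)] fun y => ‖y‖ ^ (0 : ℤ)) (j : Fin 3) :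
    Integrable fun y => fpFluxDeriv v y j j * χ y ^ 2 :=
  integrable_of_isBigO_gauge
    (continuous_mul_weight (hχ.continuous.pow 2) (chiSq_eventually_zero hχ0)
      fun y hy => continuousAt_fpFluxDeriv hv hy j j)
    (show (-5 : ℤ) + 0 ≤ -4 by norm_num)
    (isBigO_gauge_mul' (isBigO_fpFluxDeriv_gauge hvO hGO hHO j j) (isBigO_chiSq_gauge hχO))

/-- **THE WEIGHTED CONTINUUM FAR PENCIL FOR THE LINEAR-GROWTH CLASS.**  Let `v : ℝ³ → ℝ³` be `C²` with
`v = O(‖y‖)`, `∇v = O(1)`, `∇²v = O(1)` at infinity (e.g. `v` affine outside a ball — the co-rotated far field of the H12⋆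
architecture), and let `χ` be a `C²` weight with `0 ∉ tsupport χ`, `χ = O(1)`, `∇χ = O(1)` (e.g. `χ = 1` outside a ball).  Then
`∫ χ²·Num(x, v, ∇v) ≤ (17/200)·∫ χ²·Den(x, ∇v) + (1/18)·∫ 2χ⟪∇χ, Φ⟫`,
all eight integrability hypotheses of `farPencil_weighted_integral_le_of_integrable` being discharged by the decay gauges.
NOT a proof of H12⋆ (the lattice→continuum transfer and the near certificate are separate), NOT summit progress. -/
theorem farPencil_weighted_integral_le_of_growth
    (hvO : ∀ i, (fun y => v y i) =O[cocompact (Fin 3 → ℝ)] fun y => ‖y‖ ^ (1 : ℤ))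
    (hGO : ∀ i j, (fun y => fpGrad v y i j) =O[cocompact (Fin 3 → ℝ)] fun y => ‖y‖ ^ (0 : ℤ))
    (hHO : ∀ k i j, (fun y => fpHess v y k i j) =O[cocompact (Fin 3 → ℝ)] fun y => ‖y‖ ^ (0 : ℤ))
    (hχO : (fun y => χ y) =O[cocompact (Fin 3 → ℝ)] fun y => ‖y‖ ^ (0 : ℤ))
    (hχ1 : ∀ j, (fun y => fpGradS χ y j) =O[cocompact (Fin 3 → ℝ)] fun y => ‖y‖ ^ (0 : ℤ)) :
    ∫ x, χ x ^ 2 * fpNum x (v x) (fpGrad v x) ≤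
      17 / 200 * (∫ x, χ x ^ 2 * fpDen x (fpGrad v x)) + 1 / 18 * ∫ x, 2 * χ x * fpFluxDotGrad v χ x :=
  farPencil_weighted_integral_le_of_integrable hv hχ hχ0
    (integrable_sq_mul_fpNum_of_growth hv hχ hχ0 hvO hGO hχO)
    (integrable_sq_mul_fpDen_of_growth hv hχ hχ0 hGO hχO)
    (integrable_fpFluxDeriv_mul_sq_of_growth hv hχ hχ0 hvO hGO hHO hχO)
    (integrable_fpFlux_mul_grad_sq_of_growth hv hχ hχ0 hvO hGO hχO hχ1)
    (integrable_fpFlux_mul_sq_of_growth hv hχ hχ0 hvO hGO hχO)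

end main


/-! ## The affine tail: `v(y) = b + y·A` and `χ = 1` outside a ball -/

section affine
variable {v : (Fin 3 → ℝ) → (Fin 3 → ℝ)} {χ : (Fin 3 → ℝ) → ℝ} {R : ℝ} {b : Fin 3 → ℝ} {A : Fin 3 → Fin 3 → ℝ}

/-- Eventually along `cocompact ℝ³`, `R < ‖y‖`. -/
theorem eventually_cocompact_norm_gt (R : ℝ) : ∀ᶠ y : Fin 3 → ℝ in cocompact (Fin 3 → ℝ), R < ‖y‖ := by
  filter_upwards [eventually_cocompact_norm_ge (R + 1)] with y hy
  linarith

/-- An affine tail is `O(‖y‖)`. -/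
theorem isBigO_of_affineTail
    (htail : ∀ y : Fin 3 → ℝ, R ≤ ‖y‖ → ∀ j, v y j = b j + (y 0 * A 0 j + y 1 * A 1 j + y 2 * A 2 j)) (j : Fin 3) :
    (fun y => v y j) =O[cocompact (Fin 3 → ℝ)] fun y => ‖y‖ ^ (1 : ℤ) := by
  refine IsBigO.of_bound (|b j| + (|A 0 j| + |A 1 j| + |A 2 j|)) ?_
  filter_upwards [eventually_cocompact_norm_ge (max R 1)] with y hy
  have hR : R ≤ ‖y‖ := (le_max_left _ _).trans hy
  have h1 : 1 ≤ ‖y‖ := (le_max_right _ _).trans hy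
  have hc : ∀ i : Fin 3, |y i| ≤ ‖y‖ := fun i => by simpa [Real.norm_eq_abs] using norm_le_pi_norm y i
  have hb : |b j| ≤ |b j| * ‖y‖ := le_mul_of_one_le_right (abs_nonneg _) h1
  have hm : ∀ i : Fin 3, |y i * A i j| ≤ |A i j| * ‖y‖ := fun i => by
    rw [abs_mul, mul_comm]
    exact mul_le_mul_of_nonneg_left (hc i) (abs_nonneg _)
  rw [Real.norm_eq_abs, htail y hR j, zpow_one, norm_norm]
  have ht : |b j + (y 0 * A 0 j + y 1 * A 1 j + y 2 * A 2 j)| ≤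
      |b j| + (|y 0 * A 0 j| + |y 1 * A 1 j| + |y 2 * A 2 j|) := by
    refine (abs_add_le _ _).trans ?_
    have h2 := abs_add_le (y 0 * A 0 j + y 1 * A 1 j) (y 2 * A 2 j)
    have h3 := abs_add_le (y 0 * A 0 j) (y 1 * A 1 j)
    linarith
  have h0 := hm 0; have h1' := hm 1; have h2' := hm 2
  nlinarith [ht, hb, h0, h1', h2']

/-- The linear part of an affine tail as a continuous linear map, and the derivative of `v` on the tail region. -/
theorem exists_hasFDerivAt_of_affineTail
    (htail : ∀ y : Fin 3 → ℝ, R ≤ ‖y‖ → ∀ j, v y j = b j + (y 0 * A 0 j + y 1 * A 1 j + y 2 * A 2 j)) :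
    ∃ L : (Fin 3 → ℝ) →L[ℝ] (Fin 3 → ℝ), (∀ i j, L (fpE i) j = A i j) ∧
      ∀ y : Fin 3 → ℝ, R < ‖y‖ → HasFDerivAt v L y := by
  let Lₗ : (Fin 3 → ℝ) →ₗ[ℝ] (Fin 3 → ℝ) :=
    { toFun := fun z j => z 0 * A 0 j + z 1 * A 1 j + z 2 * A 2 j
      map_add' := fun z w => by funext j; simp only [Pi.add_apply]; ring
      map_smul' := fun c z => by funext j; simp only [Pi.smul_apply, smul_eq_mul, RingHom.id_apply]; ring }
  let L : (Fin 3 → ℝ) →L[ℝ] (Fin 3 → ℝ) := LinearMap.toContinuousLinearMap Lₗ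
  have hLapp : ∀ z j, L z j = z 0 * A 0 j + z 1 * A 1 j + z 2 * A 2 j := fun z j => rfl
  refine ⟨L, fun i j => ?_, fun y hy => ?_⟩
  · rw [hLapp]
    fin_cases i <;> simp [fpE]
  · -- on the open tail region `v` agrees with the affine map `z ↦ b + L z`
    have hopen : IsOpen {z : Fin 3 → ℝ | R < ‖z‖} := isOpen_lt continuous_const continuous_norm
    have hev : v =ᶠ[𝓝 y] fun z => b + L z := by
      filter_upwards [hopen.mem_nhds hy] with z hz
      funext j
      rw [htail z (le_of_lt hz) j, Pi.add_apply, hLapp]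
    exact ((L.hasFDerivAt).const_add b).congr_of_eventuallyEq hev

/-- On the tail region the gradient matrix of an affine-tailed field is the constant `A` and the Hessian vanishes. -/
theorem fpGrad_fpHess_of_affineTail
    (htail : ∀ y : Fin 3 → ℝ, R ≤ ‖y‖ → ∀ j, v y j = b j + (y 0 * A 0 j + y 1 * A 1 j + y 2 * A 2 j))
    {y : Fin 3 → ℝ} (hy : R < ‖y‖) : fpGrad v y = A ∧ fpHess v y = fun _ _ _ => 0 := by
  obtain ⟨L, hLA, hL⟩ := exists_hasFDerivAt_of_affineTail htail
  have h1 : fderiv ℝ v y = L := (hL y hy).fderiv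
  have hopen : IsOpen {z : Fin 3 → ℝ | R < ‖z‖} := isOpen_lt continuous_const continuous_norm
  have hev : fderiv ℝ v =ᶠ[𝓝 y] fun _ => L := by
    filter_upwards [hopen.mem_nhds hy] with z hz
    exact (hL z hz).fderiv
  have h2 : fderiv ℝ (fderiv ℝ v) y = 0 := by
    rw [hev.fderiv_eq]; simp
  refine ⟨?_, ?_⟩
  · funext i j
    rw [fpGrad, h1, hLA]
  · funext k i j
    simp [fpHess, h2]

/-- A weight equal to `1` on the tail region has vanishing gradient there. -/
theorem fpGradS_eq_zero_of_tail (hχ1 : ∀ y : Fin 3 → ℝ, R ≤ ‖y‖ → χ y = 1) {y : Fin 3 → ℝ} (hy : R < ‖y‖) :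
    fpGradS χ y = 0 := by
  have hopen : IsOpen {z : Fin 3 → ℝ | R < ‖z‖} := isOpen_lt continuous_const continuous_norm
  have hev : χ =ᶠ[𝓝 y] fun _ => (1 : ℝ) := by
    filter_upwards [hopen.mem_nhds hy] with z hz
    exact hχ1 z (le_of_lt hz)
  have h : fderiv ℝ χ y = 0 := by rw [hev.fderiv_eq]; simp
  funext j
  simp [fpGradS, h]

/-- **THE WEIGHTED CONTINUUM FAR PENCIL FOR AN AFFINE-TAILED FIELD** — the form the H12⋆ architecture consumes: `v ∈ C²`
AFFINE outside a (sup-norm) ball, `v y = b + y·A` for `‖y‖ ≥ R` (the co-rotated far field `−u_P − W(y − y_P)` of a finitely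
supported lattice displacement, after interpolation), and a `C²` weight `χ` with `0 ∉ tsupport χ` and `χ = 1` for `‖y‖ ≥ R`.  Then
`∫ χ²·Num(x, v, ∇v) ≤ (17/200)·∫ χ²·Den(x, ∇v) + (1/18)·∫ 2χ⟪∇χ, Φ⟫` — no compact support, no condition at the reference site,
every integrability hypothesis discharged.  NOT a proof of H12⋆ (transfer and near certificate are separate), NOT summit progress. -/
theorem farPencil_weighted_integral_le_of_affineTail (hv : ContDiff ℝ 2 v) (hχ : ContDiff ℝ 2 χ)
    (hχ0 : (0 : Fin 3 → ℝ) ∉ tsupport χ)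
    (htail : ∀ y : Fin 3 → ℝ, R ≤ ‖y‖ → ∀ j, v y j = b j + (y 0 * A 0 j + y 1 * A 1 j + y 2 * A 2 j))
    (hχ1 : ∀ y : Fin 3 → ℝ, R ≤ ‖y‖ → χ y = 1) :
    ∫ x, χ x ^ 2 * fpNum x (v x) (fpGrad v x) ≤
      17 / 200 * (∫ x, χ x ^ 2 * fpDen x (fpGrad v x)) + 1 / 18 * ∫ x, 2 * χ x * fpFluxDotGrad v χ x := by
  have hvO := isBigO_of_affineTail htail
  have hGO : ∀ i j, (fun y => fpGrad v y i j) =O[cocompact (Fin 3 → ℝ)] fun y => ‖y‖ ^ (0 : ℤ) := by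
    intro i j
    refine IsBigO.of_bound ‖A i j‖ ?_
    filter_upwards [eventually_cocompact_norm_gt R] with y hy
    rw [(fpGrad_fpHess_of_affineTail htail hy).1]
    simp
  have hHO : ∀ k i j, (fun y => fpHess v y k i j) =O[cocompact (Fin 3 → ℝ)] fun y => ‖y‖ ^ (0 : ℤ) := by
    intro k i j
    refine IsBigO.of_bound 0 ?_
    filter_upwards [eventually_cocompact_norm_gt R] with y hy
    rw [(fpGrad_fpHess_of_affineTail htail hy).2]
    simp
  have hχO : (fun y => χ y) =O[cocompact (Fin 3 → ℝ)] fun y => ‖y‖ ^ (0 : ℤ) := by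
    refine IsBigO.of_bound 1 ?_
    filter_upwards [eventually_cocompact_norm_ge R] with y hy
    rw [hχ1 y hy]
    simp
  have hχ1O : ∀ j, (fun y => fpGradS χ y j) =O[cocompact (Fin 3 → ℝ)] fun y => ‖y‖ ^ (0 : ℤ) := by
    intro j
    refine IsBigO.of_bound 0 ?_
    filter_upwards [eventually_cocompact_norm_gt R] with y hy
    rw [fpGradS_eq_zero_of_tail hχ1 hy]
    simp
  exact farPencil_weighted_integral_le_of_growth hv hχ hχ0 hvO hGO hHO hχO hχ1O

end affine

end Summit.AtomisticToContinuum.Crystallization.Theorems.StrictSplittingRuleBirth
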